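import Summits.QuantumFields.YangMills.Theorems.UnitScaleTiltFluctuationComparisonRegPrTwoCutoffTowerLimit
import Summits.QuantumFields.YangMills.Theorems.UnitScaleTiltFluctuationComparisonRegPrGlobalSlackKernelLegRefOwn
import Summits.QuantumFields.YangMills.Theorems.UnitScaleTiltFluctuationComparisonRegPrGlobalSlackKernelCauchyEstimates
import HarnessLib

/-!
# `UnitScaleTiltFluctuationComparisonRegPrTwoCutoffKerHeightFree` — THE HEIGHT-FREE REFERENCE FAMILY OF 3⁗χ FROM A ONE-FAMILY TWO-RUN ROW: `∃ Ψ, KerHeightFree Ψ ∧ (R1)` CONSTRUCTED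
# (crux `FluctuationComparisonRegPrIntL`, stmt-QuantumFields-20520, STUB 3⁗χ `stub_globalTwoRunSlackFamChi`; cell `pub/ym-inputs`, INPUT-LIST I-11 row p10, seat ym-inputs-p10 g2,
# file 2 of 2; count-neutral helper, def-free)

WHY.  See file 1 (`…TwoCutoffTowerLimit`).  By name: the sockets `K1aLegRowsRef(K)Chi` (`…KernelLegRef`), `…RefV4`, `…Display*`, `…Weighted*` all open with
`∃ Ψ, KerHeightFree Ψ ∧ …`; `flatKernelLegCauchyΦ_of_ref` / `kernelRefΦ_of_own` consume such a `Ψ`; nothing in the tree produces one.  THIS FILE PRODUCES IT from the other currency: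

* §1 **`exists_kerHeightFree_of_twoRun`** (operator norm, any refinement-closed index predicate `P K b Y`): a chart family `Φ` with symmetric flat kernels on `P` and the two-run row
  `‖kerT Φ K b Y d − ker Φ K b Y d‖ ≤ ε K b Y` (`d ∈ [2,7)`) with `ε (K+1) (b+1) (refineSet Y) ≤ ρ·ε K b Y`, `ρ < 1` ⟹ `∃ Ψ, KerHeightFree Ψ ∧ Deriv1VanishΦ Ψ ∧ Ψ(0) = 0 ∧
  (symmetric kernels) ∧ ∀ P, ‖ker Φ − ker Ψ‖ ≤ ε/(1−ρ)` — file 1's `exists_coherent_family` on the index set `(d, K, b, Y)` with the bond transport in every slot as pull-back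
  (`θ (ker Φ (s i)) = kerT Φ i` by `rfl`), then file 1's polynomial charts on the (symmetric) limit kernels.
* §2 **`exists_kerHeightFree_of_twoRun_leg`** — the same in LEG CURRENCY (every difference precomposed with `D_w^{⊗d} = legL`, matched distances `DistMatched dist`), via
  `rescaleΦw`/`kerT_rescaleW`/`ker_rescaleW` and rescaling the reference back by `−κ′` (`rescaleΦw_rescaleΦw_neg`).
* §3 the rows of record: `k1aBudget_step_le` (K1a's budget `C·e^{−κ𝓛}·(L^{−(1+b)})^a` decays by `(L⁻¹)^a` along the step when the tree length does not decrease),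
  **`exists_kernelRefOwnΦ_of_twoRun`** (general polymer parameter: an ALL-INDEX own-indexed two-run row ⟹ `∃ Ψ, KerHeightFree Ψ ∧ KernelRefOwnΦ D Φ Ψ dist κ′ κ a (C/(1−(L⁻¹)^a))`,
  i.e. (R1) — then `KernelRefΦ` by `kernelRefΦ_of_own` and K1a back by `flatKernelLegCauchyΦ_of_ref`), and at the χ-record's canonical polymerisation `refineSet_mem_canonLoc` (the
  GENUINE levels `1+b ≤ k ≤ K` are refinement-closed, `locMatched_canonCore`), `kerSymm_of_chartAnalyticΦ` (G3D-01 ⟹ Schwarz symmetry, [Chae1985] 14.13 + Mathlib), and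
  **`kernelRef_genuine_canonCore_of_flatKernelLegCauchy`**: `ChartAnalyticΦ` + `FlatKernelLegCauchyΦ D Φ (canonLegDist F) κ′ κ a C` for ONE family ⟹ a height-free `Ψ` with BOTH
  clauses of `KernelRefΦ … (C/(1−(L⁻¹)^a))` at every genuine level.  LOCATED: the socket's dummy level (`k > K`: one whole-torus domain at term level `1`, read by no row) is not
  refinement-closed — a two-run row there does not propagate; its clauses are not produced (the all-index form `exists_kernelRefOwnΦ_of_twoRun` has no such gap).
HONEST FRAMING.  A CONSTRUCTOR ∕ REDUCTION between the two currencies of 3⁗χ.  Its hypothesis — ONE chart family obeying the two-run row at EVERY cut-off — is unprovable over the per-`K`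
`Classical.choice` witnesses of `OfV3ChiAt` (finding F-g4-1) and is meant for a CANONICAL family (the (α) record's B0 charts, not in the tree); the non-abelian `d = 3` estimate
itself is unprinted (INPUT-LIST §5 item 3, E2 = NO) and is NOT asserted here; no stub, crux or registry object is touched; no summit or sub-problem statement is proved; YM₃ on T³ is a
ladder rung (R3), not the Clay problem ∕ 𝕋⁴ ∕ a mass gap.

References: C. King, CMP 102 (1986) 649–677 [King1986] (Thm 3.4 (3.9) p.656, (3.13) p.657, Prop. 3.6 (3.55)–(3.56) p.662, (3.58)–(3.61) p.663); T. Bałaban, CMP 102 (1985) 255–275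
[Balaban1985UV3] ((24)–(25) p.262, (29)–(30) p.263, (43)–(45) pp.266–267); CMP 109 (1987) 249–301 [Balaban1987RG1] ((0.1) p.251); S. B. Chae, Holomorphy and Calculus in Normed
Spaces (1985) [Chae1985] (Thm 14.13).
-/

set_option autoImplicit false

noncomputable section

open Filter Topology
open scoped BigOperators Nat
open Literature.MathematicalPhysics.QuantumFieldTheory.Balaban1983to89
open Literature.MathematicalPhysics.QuantumFieldTheory.Balaban1983to89.T3ContinuumYM3Torus
open Literature.MathematicalPhysics.QuantumFieldTheory.Balaban1983to89.T3AlphaPolymerSocket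
open Literature.MathematicalPhysics.QuantumFieldTheory.Balaban1983to89.T3AlphaInputsAC
open Literature.MathematicalPhysics.QuantumFieldTheory.Balaban1985CMP102
open Literature.MathematicalPhysics.QuantumFieldTheory.Balaban1985CMP102.Setting
open Summit.QuantumFields.Balaban3D.Carriers
open Summit.QuantumFields.Balaban3D.Proofs.Primitives
open Summit.QuantumFields.YangMills.Theorems
open Summit.QuantumFields.YangMills.Theorems.GlobalSlackKernelMatching
open Summit.QuantumFields.YangMills.Theorems.GlobalSlackKernelLeg
open Summit.QuantumFields.YangMills.Theorems.GlobalSlackCanonicalPolymers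
open Summit.QuantumFields.YangMills.Theorems.TwoCutoffTowerLimit

namespace Summit.QuantumFields.YangMills.Theorems.TwoCutoffKerHeightFree

/-! ## §1 The reference chart family from a one-family two-run row (operator norm) -/

section Charts

variable {𝕍 : Type} [NormedAddCommGroup 𝕍] [NormedSpace ℂ 𝕍] {F : T3Family}




/-- **THE HEIGHT-FREE REFERENCE FAMILY FROM A ONE-FAMILY TWO-RUN ROW (operator norm).**  Let `P K b Y` be a refinement-closed index predicate, `Φ` a chart family whose flat kernels of
orders `2 … 6` are symmetric on `P` (e.g. analytic charts) and satisfy there the TWO-RUN CAUCHY ROW `‖kerT Φ K b Y d − ker Φ K b Y d‖ ≤ ε K b Y` with budgets decaying by a factor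
`ρ < 1` along the refinement step (`ε (K+1) (b+1) (refineSet Y) ≤ ρ·ε K b Y` — K1a's rate `(L^{−(1+b)})^a` does this by itself, `ρ = L^{−a}`).  THEN there is a chart family
`Ψ` — polynomial charts `x ↦ Σ_{d∈[2,7)} (d!)⁻¹ N_{d,K,b,Y}(x,…,x)` on the tower limits `N` of the transported kernels — with `KerHeightFree Ψ` (EXACT matching across the refinement,
for every index), no constant and no linear term, and the PER-RUN CLOSENESS `‖ker Φ K b Y d − ker Ψ K b Y d‖ ≤ ε K b Y/(1 − ρ)` on `P`: the converse of `flatKernelLegCauchyΦ_of_ref`,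
[King1986] Prop. 3.6's «`k`-step kernels within `L^{−γk}` of the `n → ∞` limit kernels» obtained FROM the two-cut-off comparison rather than assumed. [cite: King1986, Prop. 3.6 (3.56) p.662, (3.58)-(3.61) p.663, (3.13) p.657] -/
theorem exists_kerHeightFree_of_twoRun (P : (K b : ℕ) → Set (Site (F.P K) 0) → Prop)
    (hP : ∀ K b Y, P K b Y → P (K + 1) (b + 1) (refineSet F K Y)) (Φ : ChartFam 𝕍 F) (ε : (K b : ℕ) → Set (Site (F.P K) 0) → ℝ) {ρ : ℝ} (hρ : ρ < 1)
    (hε : ∀ K b Y, P K b Y → ε (K + 1) (b + 1) (refineSet F K Y) ≤ ρ * ε K b Y)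
    (hrow : ∀ K b Y, P K b Y → ∀ d ∈ Finset.Ico 2 7, ‖kerT Φ K b Y d - ker Φ K b Y d‖ ≤ ε K b Y)
    (hsym : ∀ K b Y, P K b Y → ∀ d ∈ Finset.Ico 2 7, ∀ (v : Fin d → (PBond (F.P K) b → 𝕍)) (σ : Equiv.Perm (Fin d)),
      ker Φ K b Y d (fun j => v (σ j)) = ker Φ K b Y d v) :
    ∃ Ψ : ChartFam 𝕍 F, KerHeightFree Ψ ∧ Deriv1VanishΦ Ψ ∧ (∀ K b Y, Ψ K b Y 0 = 0) ∧
      (∀ (K b : ℕ) (Y : Set (Site (F.P K) 0)) (d : ℕ) (v : Fin d → (PBond (F.P K) b → 𝕍)) (σ : Equiv.Perm (Fin d)),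
        ker Ψ K b Y d (fun j => v (σ j)) = ker Ψ K b Y d v) ∧
      ∀ K b Y, P K b Y → ∀ d ∈ Finset.Ico 2 7, ‖ker Φ K b Y d - ker Ψ K b Y d‖ ≤ ε K b Y / (1 - ρ) := by
  -- the index set: (order, run, chart index, domain); the fibres: the flat-kernel spaces; the pull-backs: the bond transport in every slot
  let ι : Type := Σ _d : ℕ, Σ K : ℕ, Σ _b : ℕ, Set (Site (F.P K) 0)
  let V : ι → Type := fun i => ContinuousMultilinearMap ℂ (fun _ : Fin i.1 => PBond (F.P i.2.1) i.2.2.1 → 𝕍) ℂ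
  let s : ι → ι := fun i => ⟨i.1, i.2.1 + 1, i.2.2.1 + 1, refineSet F i.2.1 i.2.2.2⟩
  let θ : ∀ i, V (s i) → V i := fun i X => X.compContinuousLinearMap fun _ => transport 𝕍 F i.2.1 i.2.2.1
  let S : ∀ i, Set (V i) := fun i =>
    {X | ∀ (v : Fin i.1 → (PBond (F.P i.2.1) i.2.2.1 → 𝕍)) (σ : Equiv.Perm (Fin i.1)), X (fun j => v (σ j)) = X v}
  let P' : ι → Prop := fun i => i.1 ∈ Finset.Ico 2 7 ∧ P i.2.1 i.2.2.1 i.2.2.2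
  let M : ∀ i, V i := fun i => ker Φ i.2.1 i.2.2.1 i.2.2.2 i.1
  let ε' : ι → ℝ := fun i => ε i.2.1 i.2.2.1 i.2.2.2
  let δ' : ι → ℝ := fun i => ε i.2.1 i.2.2.1 i.2.2.2 / (1 - ρ)
  have h1ρ : 0 < 1 - ρ := by linarith
  have hθ : ∀ i (x y : V (s i)), ‖θ i x - θ i y‖ ≤ ‖x - y‖ := by
    rintro ⟨d, K, b, Y⟩ x y
    show ‖x.compContinuousLinearMap (fun _ => transport 𝕍 F K b) - y.compContinuousLinearMap (fun _ => transport 𝕍 F K b)‖ ≤ ‖x - y‖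
    rw [← sub_compContinuousLinearMap']
    exact norm_compContinuousLinearMap_le_of_norm_le_one _ (opNorm_transport_le K b)
  have hθ0 : ∀ i, θ i 0 = 0 := by
    rintro ⟨d, K, b, Y⟩
    show (0 : ContinuousMultilinearMap ℂ (fun _ : Fin d => PBond (F.P (K + 1)) (b + 1) → 𝕍) ℂ).compContinuousLinearMap
        (fun _ => transport 𝕍 F K b) = 0
    ext v
    simp [ContinuousMultilinearMap.compContinuousLinearMap_apply]
  have hSc : ∀ i, IsClosed (S i) := by
    rintro ⟨d, K, b, Y⟩
    exact isClosed_setOf_symmetric (PBond (F.P K) b → 𝕍) d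
  have hS0 : ∀ i, (0 : V i) ∈ S i := by
    rintro ⟨d, K, b, Y⟩ v σ
    rfl
  have hSθ : ∀ i (x : V (s i)), x ∈ S (s i) → θ i x ∈ S i := by
    rintro ⟨d, K, b, Y⟩ x hx v σ
    show x.compContinuousLinearMap (fun _ => transport 𝕍 F K b) (fun j => v (σ j)) = x.compContinuousLinearMap (fun _ => transport 𝕍 F K b) v
    simp only [ContinuousMultilinearMap.compContinuousLinearMap_apply]
    exact hx (fun j => transport 𝕍 F K b (v j)) σ
  have hP' : ∀ i, P' i → P' (s i) := by
    rintro ⟨d, K, b, Y⟩ ⟨hd, hY⟩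
    exact ⟨hd, hP K b Y hY⟩
  have hMS : ∀ i, P' i → M i ∈ S i := by
    rintro ⟨d, K, b, Y⟩ ⟨hd, hY⟩ v σ
    exact hsym K b Y hY d hd v σ
  have hM : ∀ i, P' i → ‖θ i (M (s i)) - M i‖ ≤ ε' i := by
    rintro ⟨d, K, b, Y⟩ ⟨hd, hY⟩
    show ‖kerT Φ K b Y d - ker Φ K b Y d‖ ≤ ε K b Y
    exact hrow K b Y hY d hd
  have hεnn : ∀ i, P' i → 0 ≤ ε' i := by
    rintro ⟨d, K, b, Y⟩ ⟨hd, hY⟩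
    exact (norm_nonneg _).trans (hrow K b Y hY d hd)
  have hδ : ∀ i, P' i → ε' i + δ' (s i) ≤ δ' i := by
    rintro ⟨d, K, b, Y⟩ ⟨hd, hY⟩
    show ε K b Y + ε (K + 1) (b + 1) (refineSet F K Y) / (1 - ρ) ≤ ε K b Y / (1 - ρ)
    have h := hε K b Y hY
    rw [show ε K b Y + ε (K + 1) (b + 1) (refineSet F K Y) / (1 - ρ) =
        (ε K b Y * (1 - ρ) + ε (K + 1) (b + 1) (refineSet F K Y)) / (1 - ρ) by field_simp]
    exact div_le_div_of_nonneg_right (by nlinarith) h1ρ.le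
  have hδ0 : ∀ i, P' i → 0 ≤ δ' i := fun i hi => div_nonneg (hεnn i hi) h1ρ.le
  obtain ⟨N, hcoh, hNS, hb⟩ := exists_coherent_family s θ hθ hθ0 S hSc hS0 hSθ P' hP' M hMS ε' δ' hM hδ hδ0
  -- the reference chart family: diagonal polynomials on the limit kernels
  set Ψ : ChartFam 𝕍 F := fun K b Y x => ∑ n ∈ Finset.Ico 2 7, ((n ! : ℂ))⁻¹ * N ⟨n, K, b, Y⟩ (fun _ => x) with hΨ
  have hker : ∀ (K b : ℕ) (Y : Set (Site (F.P K) 0)), ∀ d ∈ Finset.Ico 2 7, ker Ψ K b Y d = N ⟨d, K, b, Y⟩ := fun K b Y d hd =>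
    iteratedFDeriv_polyChart_eq (E := PBond (F.P K) b → 𝕍) (fun n => N ⟨n, K, b, Y⟩) (fun n _ v σ => hNS ⟨n, K, b, Y⟩ v σ) hd
  have hker0 : ∀ (K b : ℕ) (Y : Set (Site (F.P K) 0)), ∀ d ∉ Finset.Ico 2 7, ker Ψ K b Y d = 0 := fun K b Y d hd =>
    iteratedFDeriv_polyChart_eq_zero (E := PBond (F.P K) b → 𝕍) (fun n => N ⟨n, K, b, Y⟩) hd
  refine ⟨Ψ, ?_, ?_, ?_, ?_, ?_⟩
  · -- `KerHeightFree`: the exact coherence of the limit kernels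
    intro K b Y d hd
    show (ker Ψ (K + 1) (b + 1) (refineSet F K Y) d).compContinuousLinearMap (fun _ => transport 𝕍 F K b) = ker Ψ K b Y d
    rw [hker K b Y d hd, hker (K + 1) (b + 1) (refineSet F K Y) d hd]
    exact hcoh ⟨d, K, b, Y⟩
  · -- no linear term
    intro K b Y
    exact fderiv_polyChart_zero (E := PBond (F.P K) b → 𝕍) fun n => N ⟨n, K, b, Y⟩
  · -- no constant term
    intro K b Y
    exact polyChart_zero (E := PBond (F.P K) b → 𝕍) fun n => N ⟨n, K, b, Y⟩
  · -- symmetric kernels (all orders)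
    intro K b Y d v σ
    by_cases hd : d ∈ Finset.Ico 2 7
    · rw [hker K b Y d hd]
      exact hNS ⟨d, K, b, Y⟩ v σ
    · rw [hker0 K b Y d hd]
      rfl
  · -- the per-run closeness on `P`
    intro K b Y hY d hd
    rw [hker K b Y d hd]
    exact hb ⟨d, K, b, Y⟩ ⟨hd, hY⟩

end Charts

/-! ## §2 Leg currency: the weighted row (matched distances) -/

section Leg

variable {𝕍 : Type} [NormedAddCommGroup 𝕍] [NormedSpace ℂ 𝕍] {F : T3Family}

/-- `D_{−κ′} ∘ D_{κ′} = id` for the bond-diagonal leg weights (`e^{−κ′d}·e^{κ′d} = 1`). [folklore] -/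
theorem legD_neg_legD (dist : LegDist F) (κ' : ℝ) (K b : ℕ) (Y : Set (Site (F.P K) 0)) (z : PBond (F.P K) b → 𝕍) :
    legD 𝕍 dist (-κ') K b Y (legD 𝕍 dist κ' K b Y z) = z := by
  funext c
  rw [legD_apply, legD_apply, smul_smul, legW, legW, ← Complex.ofReal_mul, ← Real.exp_add, neg_mul, neg_add_cancel, Real.exp_zero,
    Complex.ofReal_one, one_smul]

/-- `D_{κ′} ∘ D_{−κ′} = id`. [folklore] -/
theorem legD_legD_neg (dist : LegDist F) (κ' : ℝ) (K b : ℕ) (Y : Set (Site (F.P K) 0)) (z : PBond (F.P K) b → 𝕍) :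
    legD 𝕍 dist κ' K b Y (legD 𝕍 dist (-κ') K b Y z) = z := by
  simpa only [neg_neg] using legD_neg_legD dist (-κ') K b Y z

/-- Rescaling by `κ′` undoes rescaling by `−κ′`: `rescaleΦw dist κ′ (rescaleΦw dist (−κ′) Ψ) = Ψ`. [folklore] -/
theorem rescaleΦw_rescaleΦw_neg (dist : LegDist F) (κ' : ℝ) (Ψ : ChartFam 𝕍 F) : rescaleΦw dist κ' (rescaleΦw dist (-κ') Ψ) = Ψ := by
  funext K b Y z
  show Ψ K b Y (legD 𝕍 dist (-κ') K b Y (legD 𝕍 dist κ' K b Y z)) = Ψ K b Y z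
  rw [legD_neg_legD]


/-- **THE HEIGHT-FREE REFERENCE FAMILY FROM A ONE-FAMILY TWO-RUN ROW — LEG CURRENCY** (matched leg distances `DistMatched dist`): the same as `exists_kerHeightFree_of_twoRun` with every
kernel difference precomposed with the leg weights `D_w^{⊗d}` (`legL`), i.e. in the currency of `FlatKernelLegCauchyΦ` / `KernelRefΦ` / `KernelRefOwnΦ`: a two-run row
`‖(kerT Φ − ker Φ)_{K,b,Y} ∘ D_w^{⊗d}‖ ≤ ε K b Y` on a refinement-closed `P` with `ε(step) ≤ ρ·ε`, `ρ < 1`, symmetric kernels ⟹ `∃ Ψ, KerHeightFree Ψ ∧ Deriv1VanishΦ Ψ ∧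
‖(ker Φ − ker Ψ)_{K,b,Y} ∘ D_w^{⊗d}‖ ≤ ε K b Y/(1−ρ)` on `P` (apply the operator-norm theorem to the rescaled family `rescaleΦw dist κ′ Φ`, `kerT_rescaleW`/`ker_rescaleW`, and rescale
the reference back by `−κ′`). [cite: King1986, Prop. 3.6 (3.56) p.662, (3.58)-(3.61) p.663; Balaban1985UV3, (43) p.266, (45) p.267] -/
theorem exists_kerHeightFree_of_twoRun_leg (P : (K b : ℕ) → Set (Site (F.P K) 0) → Prop)
    (hP : ∀ K b Y, P K b Y → P (K + 1) (b + 1) (refineSet F K Y)) (Φ : ChartFam 𝕍 F) {dist : LegDist F} (hm : DistMatched dist) (κ' : ℝ)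
    (ε : (K b : ℕ) → Set (Site (F.P K) 0) → ℝ) {ρ : ℝ} (hρ : ρ < 1) (hε : ∀ K b Y, P K b Y → ε (K + 1) (b + 1) (refineSet F K Y) ≤ ρ * ε K b Y)
    (hrow : ∀ K b Y, P K b Y → ∀ d ∈ Finset.Ico 2 7,
      ‖(kerT Φ K b Y d - ker Φ K b Y d).compContinuousLinearMap fun _ => legL 𝕍 dist κ' K b Y‖ ≤ ε K b Y)
    (hsym : ∀ K b Y, P K b Y → ∀ d ∈ Finset.Ico 2 7, ∀ (v : Fin d → (PBond (F.P K) b → 𝕍)) (σ : Equiv.Perm (Fin d)),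
      ker Φ K b Y d (fun j => v (σ j)) = ker Φ K b Y d v) :
    ∃ Ψ : ChartFam 𝕍 F, KerHeightFree Ψ ∧ Deriv1VanishΦ Ψ ∧ (∀ K b Y, Ψ K b Y 0 = 0) ∧
      (∀ (K b : ℕ) (Y : Set (Site (F.P K) 0)) (d : ℕ) (v : Fin d → (PBond (F.P K) b → 𝕍)) (σ : Equiv.Perm (Fin d)),
        ker Ψ K b Y d (fun j => v (σ j)) = ker Ψ K b Y d v) ∧
      ∀ K b Y, P K b Y → ∀ d ∈ Finset.Ico 2 7,
        ‖(ker Φ K b Y d - ker Ψ K b Y d).compContinuousLinearMap fun _ => legL 𝕍 dist κ' K b Y‖ ≤ ε K b Y / (1 - ρ) := by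
  -- the rescaled family obeys the operator-norm row
  have hrow₁ : ∀ K b Y, P K b Y → ∀ d ∈ Finset.Ico 2 7,
      ‖kerT (rescaleΦw dist κ' Φ) K b Y d - ker (rescaleΦw dist κ' Φ) K b Y d‖ ≤ ε K b Y := by
    intro K b Y hY d hd
    rw [kerT_rescaleW hm, ker_rescaleW, ← sub_compContinuousLinearMap]
    exact hrow K b Y hY d hd
  have hsym₁ : ∀ K b Y, P K b Y → ∀ d ∈ Finset.Ico 2 7, ∀ (v : Fin d → (PBond (F.P K) b → 𝕍)) (σ : Equiv.Perm (Fin d)),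
      ker (rescaleΦw dist κ' Φ) K b Y d (fun j => v (σ j)) = ker (rescaleΦw dist κ' Φ) K b Y d v := by
    intro K b Y hY d hd v σ
    rw [ker_rescaleW]
    exact symmetric_compContinuousLinearMap (hsym K b Y hY d hd) _ v σ
  obtain ⟨Ψ₁, hHF, hD1, h0, hsy, hb⟩ := exists_kerHeightFree_of_twoRun P hP (rescaleΦw dist κ' Φ) ε hρ hε hrow₁ hsym₁
  refine ⟨rescaleΦw dist (-κ') Ψ₁, ?_, ?_, ?_, ?_, ?_⟩
  · -- height-freeness survives the rescaling (matched distances)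
    intro K b Y d hd
    rw [kerT_rescaleW hm, hHF K b Y d hd, ← ker_rescaleW]
  · -- no linear term: chain rule through the weight isomorphism
    intro K b Y
    show fderiv ℂ (Ψ₁ K b Y ∘ ⇑(legD 𝕍 dist (-κ') K b Y)) 0 = 0
    rw [(legD 𝕍 dist (-κ') K b Y).comp_right_fderiv, map_zero, hD1 K b Y, ContinuousLinearMap.zero_comp]
  · intro K b Y
    show Ψ₁ K b Y (legD 𝕍 dist (-κ') K b Y 0) = 0
    rw [map_zero, h0]
  · intro K b Y d v σ
    rw [ker_rescaleW]
    exact symmetric_compContinuousLinearMap (hsy K b Y d) _ v σ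
  · intro K b Y hY d hd
    rw [sub_compContinuousLinearMap, ← ker_rescaleW, ← ker_rescaleW, rescaleΦw_rescaleΦw_neg]
    exact hb K b Y hY d hd

end Leg

/-! ## §3 The rows of record -/

section Record

variable {𝕍 : Type} [NormedAddCommGroup 𝕍] [NormedSpace ℂ 𝕍] {F : T3Family} {γ : ℝ}

/-- The K1a rate decays by the fixed factor `(L⁻¹)^a` along the refinement step: `((L^{1+(b+1)})⁻¹)^a = ((L^{1+b})⁻¹)^a · (L⁻¹)^a` (`1 ≤ L`). [folklore] -/
theorem rate_succ_eq {L : ℕ} (hL : 1 ≤ L) (a : ℝ) (b : ℕ) :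
    (((L : ℝ) ^ (1 + (b + 1)))⁻¹) ^ a = (((L : ℝ) ^ (1 + b))⁻¹) ^ a * ((L : ℝ)⁻¹) ^ a := by
  have hL0 : (0 : ℝ) ≤ L := by positivity
  rw [← Real.mul_rpow (by positivity) (by positivity), show 1 + (b + 1) = (1 + b) + 1 by ring, pow_succ, mul_inv]

/-- **THE K1a BUDGET DECAYS GEOMETRICALLY ALONG THE TOWER** when the tree length does not decrease under the refinement: with `ε K b Y := C·e^{−κ𝓛_K(1+b,Y)}·(L^{−(1+b)})^a`,
`ε (K+1) (b+1) (refineSet Y) ≤ (L⁻¹)^a · ε K b Y` (`0 ≤ κ`, `0 ≤ C`, `1 ≤ L`). [cite: King1986, Prop. 3.6 (3.56) p.662] -/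
theorem k1aBudget_step_le {D : AlphaDataT3 F γ} {κ C a : ℝ} (hκ : 0 ≤ κ) (hC : 0 ≤ C) (hL : 1 ≤ F.L) {K b : ℕ} {Y : Set (Site (F.P K) 0)}
    (hT : D.treeLen K (1 + b) Y ≤ D.treeLen (K + 1) (1 + (b + 1)) (refineSet F K Y)) :
    C * Real.exp (-κ * D.treeLen (K + 1) (1 + (b + 1)) (refineSet F K Y)) * (((F.L : ℝ) ^ (1 + (b + 1)))⁻¹) ^ a ≤
      ((F.L : ℝ)⁻¹) ^ a * (C * Real.exp (-κ * D.treeLen K (1 + b) Y) * (((F.L : ℝ) ^ (1 + b))⁻¹) ^ a) := by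
  have hexp : Real.exp (-κ * D.treeLen (K + 1) (1 + (b + 1)) (refineSet F K Y)) ≤ Real.exp (-κ * D.treeLen K (1 + b) Y) :=
    Real.exp_le_exp.mpr (by nlinarith)
  rw [rate_succ_eq hL a b]
  have hr : 0 ≤ (((F.L : ℝ) ^ (1 + b))⁻¹) ^ a * ((F.L : ℝ)⁻¹) ^ a := by positivity
  calc C * Real.exp (-κ * D.treeLen (K + 1) (1 + (b + 1)) (refineSet F K Y)) * ((((F.L : ℝ) ^ (1 + b))⁻¹) ^ a * ((F.L : ℝ)⁻¹) ^ a)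
      ≤ C * Real.exp (-κ * D.treeLen K (1 + b) Y) * ((((F.L : ℝ) ^ (1 + b))⁻¹) ^ a * ((F.L : ℝ)⁻¹) ^ a) :=
        mul_le_mul_of_nonneg_right (mul_le_mul_of_nonneg_left hexp hC) hr
    _ = ((F.L : ℝ)⁻¹) ^ a * (C * Real.exp (-κ * D.treeLen K (1 + b) Y) * (((F.L : ℝ) ^ (1 + b))⁻¹) ^ a) := by ring

/-- The tower ratio `(L⁻¹)^a` is `< 1` for `1 < L`, `0 < a`. [folklore] -/
theorem ratio_lt_one {L : ℕ} (hL : 1 < L) {a : ℝ} (ha : 0 < a) : ((L : ℝ)⁻¹) ^ a < 1 :=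
  Real.rpow_lt_one (by positivity) (inv_lt_one_of_one_lt₀ (by exact_mod_cast hL)) ha

/-- **(R1) `KernelRefOwnΦ` FROM AN ALL-INDEX ONE-FAMILY TWO-RUN ROW** (general polymer parameter; hypotheses: matched leg distances, tree length non-decreasing under the refinement for
EVERY point set, `0 ≤ κ`, `0 ≤ C`, `0 < a`, `1 < L`): if ONE chart family `Φ` with symmetric flat kernels satisfies the own-indexed weighted two-run row
`‖(kerT Φ − ker Φ)_{K,b,Y} ∘ D_w^{⊗d}‖ ≤ C·e^{−κ𝓛_K(1+b,Y)}·(L^{−(1+b)})^a` for every `(K, b, Y)` and `d ∈ [2,7)`, then the height-free reference family of (R1) EXISTS, with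
`KernelRefOwnΦ D Φ Ψ dist κ′ κ a (C/(1 − (L⁻¹)^a))` — hence `KernelRefΦ` by `kernelRefΦ_of_own`/`kernelRefΦ_canonCore_of_own` and K1a back by `flatKernelLegCauchyΦ_of_ref`.
HONEST: the hypothesis is a row about ONE family at EVERY cut-off — meant for a canonical family (the (α) record's B0 charts), not for per-`K` choice witnesses (F-g4-1); nothing of
[King1986]/[Balaban1985UV3] is asserted. [cite: King1986, Thm 3.4 (3.9) p.656, Prop. 3.6 (3.56) p.662, (3.58)-(3.61) p.663; Balaban1985UV3, (43) p.266, (45) p.267] -/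
theorem exists_kernelRefOwnΦ_of_twoRun (D : AlphaDataT3 F γ) (Φ : ChartFam 𝕍 F) {dist : LegDist F} (hm : DistMatched dist) {κ' κ a C : ℝ}
    (hκ : 0 ≤ κ) (hC : 0 ≤ C) (ha : 0 < a) (hL : 1 < F.L)
    (hT : ∀ (K b : ℕ) (Y : Set (Site (F.P K) 0)), D.treeLen K (1 + b) Y ≤ D.treeLen (K + 1) (1 + (b + 1)) (refineSet F K Y))
    (hrow : ∀ (K b : ℕ) (Y : Set (Site (F.P K) 0)), ∀ d ∈ Finset.Ico 2 7,
      ‖(kerT Φ K b Y d - ker Φ K b Y d).compContinuousLinearMap fun _ => legL 𝕍 dist κ' K b Y‖ ≤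
        C * Real.exp (-κ * D.treeLen K (1 + b) Y) * (((F.L : ℝ) ^ (1 + b))⁻¹) ^ a)
    (hsym : ∀ (K b : ℕ) (Y : Set (Site (F.P K) 0)), ∀ d ∈ Finset.Ico 2 7, ∀ (v : Fin d → (PBond (F.P K) b → 𝕍)) (σ : Equiv.Perm (Fin d)),
      ker Φ K b Y d (fun j => v (σ j)) = ker Φ K b Y d v) :
    ∃ Ψ : ChartFam 𝕍 F, KerHeightFree Ψ ∧ Deriv1VanishΦ Ψ ∧ KernelRefOwnΦ D Φ Ψ dist κ' κ a (C / (1 - ((F.L : ℝ)⁻¹) ^ a)) := by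
  have hL1 : 1 ≤ F.L := hL.le
  obtain ⟨Ψ, hHF, hD1, -, -, hb⟩ := exists_kerHeightFree_of_twoRun_leg (fun _ _ _ => True) (fun _ _ _ _ => trivial) Φ hm κ'
    (fun K b Y => C * Real.exp (-κ * D.treeLen K (1 + b) Y) * (((F.L : ℝ) ^ (1 + b))⁻¹) ^ a) (ratio_lt_one hL ha)
    (fun K b Y _ => k1aBudget_step_le hκ hC hL1 (hT K b Y)) (fun K b Y _ => hrow K b Y) (fun K b Y _ => hsym K b Y)
  refine ⟨Ψ, hHF, hD1, fun K b Y d hd => ?_⟩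
  have h := hb K b Y trivial d hd
  rwa [show C * Real.exp (-κ * D.treeLen K (1 + b) Y) * (((F.L : ℝ) ^ (1 + b))⁻¹) ^ a / (1 - ((F.L : ℝ)⁻¹) ^ a) =
      C / (1 - ((F.L : ℝ)⁻¹) ^ a) * Real.exp (-κ * D.treeLen K (1 + b) Y) * (((F.L : ℝ) ^ (1 + b))⁻¹) ^ a by ring] at h

end Record

section Canon

variable {𝕍 : Type} [NormedAddCommGroup 𝕍] [NormedSpace ℂ 𝕍] {F : T3Family} {𝔠 : AlphaConsts F.L (suGroupModel 2).N} {γ : ℝ} {hγ : 0 < γ}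
  {hγ1 : γ ≤ (min 𝔠.gamma0 1) ^ 2}

/-- **THE GENUINE LOCALISATION LEVELS ARE REFINEMENT-CLOSED at the χ-record's canonical polymerisation**: for `1 + b ≤ k ≤ K` and `Y ∈ Loc K k triv (1+b)`, the refined set is a
listed domain one run up, `refineSet Y ∈ Loc (K+1) (k+1) triv (1+(b+1))` (`locMatched_canonCore` at height `n = K − k`). (Above the top, `k > K`, the canonical polymerisation lists
only the dummy whole-torus domain at term level `1`, read by no socket row; that level is NOT refinement-closed and is excluded here.) [cite: Balaban1985UV3, (24) p.262, (43) p.266; Balaban1987RG1, (0.1) p.251] -/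
theorem refineSet_mem_canonLoc (q : ∀ K, AlphaInputsT3AC.PkgCoreV3 F 𝔠 γ hγ hγ1 K) {K k b : ℕ} (hk : k ≤ K) (hbk : 1 + b ≤ k) {Y : Set (Site (F.P K) 0)}
    (hY : Y ∈ (AlphaInputsT3AC.dataOfCoreV3 q (canonPolymerCore q)).Loc K k ((AlphaInputsT3AC.dataOfCoreV3 q (canonPolymerCore q)).triv K k) (1 + b)) :
    refineSet F K Y ∈ (AlphaInputsT3AC.dataOfCoreV3 q (canonPolymerCore q)).Loc (K + 1) (k + 1)
      ((AlphaInputsT3AC.dataOfCoreV3 q (canonPolymerCore q)).triv (K + 1) (k + 1)) (1 + (b + 1)) := by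
  have hmaps := (locMatched_canonCore q K (K - k) (by omega) (1 + b) (by omega) (by omega)).mapsTo
  rw [show K - (K - k) = k by omega, show K + 1 - (K - k) = k + 1 by omega] at hmaps
  rw [show 1 + (b + 1) = 1 + b + 1 by ring]
  exact Finset.mem_coe.mp (hmaps (Finset.mem_coe.mpr hY))

/-- **DISPLAYED CHART ANALYTICITY GIVES SYMMETRIC FLAT KERNELS** (G3D-01 `ChartAnalyticΦ` ⟹ the Schwarz symmetry of `D^dΦ(0)`: holomorphic on `ball 0 ρ` ⟹ analytic at `0`
(tree `HolomorphicBanach.analyticAt_of_differentiableOn`, [Chae1985] 14.13) ⟹ Mathlib `ContDiffAt.iteratedFDeriv_comp_perm`). [cite: Balaban1985UV3, (29)-(30) p.263] -/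
theorem kerSymm_of_chartAnalyticΦ {D : AlphaDataT3 F γ} {Φ : ChartFam 𝕍 F} {κA ρA C_A : ℝ} (hA : ChartAnalyticΦ D Φ κA ρA C_A)
    {K k b : ℕ} {Y : Set (Site (F.P K) 0)} (hY : Y ∈ D.Loc K k (D.triv K k) (1 + b)) (d : ℕ) (v : Fin d → (PBond (F.P K) b → 𝕍)) (σ : Equiv.Perm (Fin d)) :
    ker Φ K b Y d (fun j => v (σ j)) = ker Φ K b Y d v := by
  obtain ⟨hρ, hdiff, -⟩ := (hA K k b Y hY).1
  exact ((Literature.Analysis.Complex.HolomorphicBanach.analyticAt_of_differentiableOn hdiff Metric.isOpen_ball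
    (Metric.mem_ball_self hρ)).contDiffAt (n := ⊤)).iteratedFDeriv_comp_perm v σ

/-- **K1a OF RECORD FOR ONE FAMILY ⟹ THE REFERENCE FORM OF RECORD ON THE GENUINE LEVELS** (χ-record's canonical polymerisation, canonical leg distance).  If ONE chart family `Φ`
carries the displayed analyticity `ChartAnalyticΦ` and the two-run row `FlatKernelLegCauchyΦ D Φ (canonLegDist F) κ′ κ a C` (`0 ≤ κ`, `0 ≤ C`, `0 < a`), then there is a height-free
reference family `Ψ` (`KerHeightFree Ψ`, `Deriv1VanishΦ Ψ`) such that BOTH clauses of `KernelRefΦ D Φ Ψ (canonLegDist F) κ′ κ a (C/(1−(L⁻¹)^a))` hold at every GENUINE level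
`1 + b ≤ k ≤ K` (geometry: `canonLegDist_matched`, `treeLenRefinedOn_canonCore`, `refineSet_mem_canonLoc`, `norm_kerT_sub_compLegL_le`).  The clauses of the socket at the dummy
level `k > K` (one whole-torus domain at term level `1`, read by no row) are not produced: a two-run row there does not propagate along the refinement.  HONEST: a reduction between the
two currencies of 3⁗χ for ONE family at EVERY cut-off (a canonical family's K1a estimate — unprinted for non-abelian `d = 3`); nothing of print is asserted; no stub is discharged.
[cite: King1986, Thm 3.4 (3.9) p.656, Prop. 3.6 (3.56) p.662, (3.58)-(3.61) p.663; Balaban1985UV3, (24)-(25) p.262, (43) p.266, (45) p.267] -/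
theorem kernelRef_genuine_canonCore_of_flatKernelLegCauchy (p : ∀ K, AlphaInputsT3AC.PkgAtV3Chi F 𝔠 γ hγ hγ1 K) {Φ : ChartFam 𝕍 F} {κ' κ a C κA ρA C_A : ℝ}
    (hκ : 0 ≤ κ) (hC : 0 ≤ C) (ha : 0 < a)
    (hA : ChartAnalyticΦ (AlphaInputsT3AC.dataOfV3chi p (canonPolymerCore fun K => (p K).toCore)) Φ κA ρA C_A)
    (hK1a : FlatKernelLegCauchyΦ (AlphaInputsT3AC.dataOfV3chi p (canonPolymerCore fun K => (p K).toCore)) Φ (canonLegDist F) κ' κ a C) :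
    ∃ Ψ : ChartFam 𝕍 F, KerHeightFree Ψ ∧ Deriv1VanishΦ Ψ ∧
      ∀ (K k b : ℕ) (Y : Set (Site (F.P K) 0)), k ≤ K → 1 + b ≤ k →
        Y ∈ (AlphaInputsT3AC.dataOfV3chi p (canonPolymerCore fun K => (p K).toCore)).Loc K k
          ((AlphaInputsT3AC.dataOfV3chi p (canonPolymerCore fun K => (p K).toCore)).triv K k) (1 + b) →
        ∀ d ∈ Finset.Ico 2 7,
          ‖(ker Φ K b Y d - ker Ψ K b Y d).compContinuousLinearMap fun _ => legL 𝕍 (canonLegDist F) κ' K b Y‖ ≤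
              C / (1 - ((F.L : ℝ)⁻¹) ^ a) * Real.exp (-κ * (AlphaInputsT3AC.dataOfV3chi p (canonPolymerCore fun K => (p K).toCore)).treeLen K (1 + b) Y) *
                (((F.L : ℝ) ^ (1 + b))⁻¹) ^ a ∧
          ‖(kerT Φ K b Y d - kerT Ψ K b Y d).compContinuousLinearMap fun _ => legL 𝕍 (canonLegDist F) κ' K b Y‖ ≤
              C / (1 - ((F.L : ℝ)⁻¹) ^ a) * Real.exp (-κ * (AlphaInputsT3AC.dataOfV3chi p (canonPolymerCore fun K => (p K).toCore)).treeLen K (1 + b) Y) *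
                (((F.L : ℝ) ^ (1 + b))⁻¹) ^ a := by
  set D := AlphaInputsT3AC.dataOfV3chi p (canonPolymerCore fun K => (p K).toCore) with hD
  set ρ : ℝ := ((F.L : ℝ)⁻¹) ^ a with hρdef
  have hL : 1 < F.L := F.hL.2
  have hL1 : 1 ≤ F.L := hL.le
  have hρ : ρ < 1 := ratio_lt_one hL ha
  have hρ0 : 0 ≤ ρ := by positivity
  have hTR : TreeLenRefinedOn D := treeLenRefinedOn_canonCore fun K => (p K).toCore
  -- the genuine levels are refinement-closed
  let P : (K b : ℕ) → Set (Site (F.P K) 0) → Prop := fun K b Y => ∃ k, k ≤ K ∧ 1 + b ≤ k ∧ Y ∈ D.Loc K k (D.triv K k) (1 + b)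
  have hP : ∀ K b Y, P K b Y → P (K + 1) (b + 1) (refineSet F K Y) := by
    rintro K b Y ⟨k, hk, hbk, hY⟩
    exact ⟨k + 1, by omega, by omega, refineSet_mem_canonLoc (fun K => (p K).toCore) hk hbk hY⟩
  let ε : (K b : ℕ) → Set (Site (F.P K) 0) → ℝ := fun K b Y => C * Real.exp (-κ * D.treeLen K (1 + b) Y) * (((F.L : ℝ) ^ (1 + b))⁻¹) ^ a
  have hε : ∀ K b Y, P K b Y → ε (K + 1) (b + 1) (refineSet F K Y) ≤ ρ * ε K b Y := by
    rintro K b Y ⟨k, hk, hbk, hY⟩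
    exact k1aBudget_step_le hκ hC hL1 (hTR K k b Y hY)
  obtain ⟨Ψ, hHF, hD1, -, -, hb⟩ := exists_kerHeightFree_of_twoRun_leg P hP Φ (canonLegDist_matched F) κ' ε hρ hε
    (by rintro K b Y ⟨k, hk, hbk, hY⟩ d hd; exact hK1a K k b Y hY d hd)
    (by rintro K b Y ⟨k, hk, hbk, hY⟩ d hd v σ; exact kerSymm_of_chartAnalyticΦ hA hY d v σ)
  have hshape : ∀ (K b : ℕ) (Y : Set (Site (F.P K) 0)), ε K b Y / (1 - ρ) =
      C / (1 - ρ) * Real.exp (-κ * D.treeLen K (1 + b) Y) * (((F.L : ℝ) ^ (1 + b))⁻¹) ^ a := fun K b Y => by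
    simp only [ε]; ring
  refine ⟨Ψ, hHF, hD1, fun K k b Y hk hbk hY d hd => ⟨?_, ?_⟩⟩
  · rw [← hshape]
    exact hb K b Y ⟨k, hk, hbk, hY⟩ d hd
  · -- run `K+1`'s clause: its own clause at `(K+1, b+1, refineSet Y)` (a genuine level one run up), transported by a contraction, tree length and rate monotone
    have hY' := refineSet_mem_canonLoc (fun K => (p K).toCore) hk hbk hY
    have hown := hb (K + 1) (b + 1) (refineSet F K Y) ⟨k + 1, by omega, by omega, hY'⟩ d hd
    refine (norm_kerT_sub_compLegL_le (canonLegDist_matched F) κ' Φ Ψ K b Y d).trans (hown.trans ?_)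
    have h1ρ : 0 < 1 - ρ := by linarith
    have hstep := k1aBudget_step_le (D := D) (a := a) hκ hC hL1 (hTR K k b Y hY)
    have hεnn : 0 ≤ ε K b Y := by simp only [ε]; positivity
    rw [← hshape]
    refine div_le_div_of_nonneg_right (hstep.trans ?_) h1ρ.le
    calc ρ * ε K b Y ≤ 1 * ε K b Y := mul_le_mul_of_nonneg_right hρ.le hεnn
      _ = ε K b Y := one_mul _

end Canon

end Summit.QuantumFields.YangMills.Theorems.TwoCutoffKerHeightFree

end
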